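import Literature.Computability.AlgebraicComplexity.DIP20MonomialCounts
import HarnessLib

/-!
# A kernel-checkable table of the Gaussian coefficients `p_k(ℓ, m)` (the `q`-Pascal rule)

Topic `Literature/Computability/AlgebraicComplexity`; an EVALUATOR file (D-0014): no facts. The
definitions introduced (`GaussTable.addCoeffs`, `GaussTable.sweep`, `GaussTable.rows`,
`GaussTable.coeffList`, `GaussTable.strictBetween`) are evaluator plumbing; the theorems certify them
against the tree's `boxPartitionCount k ℓ m` (= DIP20's `p_k(ℓ,m)`, the number of partitions of `k` with at
most `ℓ` parts each at most `m`, i.e. the coefficient of `q^k` in the Gaussian binomial `binom(ℓ+m, ℓ)_q`).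

Purpose. Pak–Panova 2013, Thm. 6 (proof): "A direct calculation gives strict unimodality for each
`ℓ ∈ {8,…,15}`, and `8 ≤ m < 16`" — the finite base of the induction proving their Thm. 1 (strict
unimodality of the `q`-binomial coefficients for `ℓ, m ≥ 8`), see the sibling
`PP13StrictUnimodalityProofs.lean`. The enumerating evaluator `boxCount` of
`DIP20KeyDifferenceFormula.lean` (t07) lists the partitions in the box and is out of reach at `15 × 15`
(`binom(30,15) ≈ 1.55·10⁸` partitions); this file tabulates all coefficients of `binom(ℓ+m, ℓ)_q` by the
`q`-Pascal rule `p_s(d+1, n+1) = p_s(d, n+1) + p_{s-(d+1)}(d+1, n)` (Andrews, *The Theory of Partitions*,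
(3.3.4); in the tree `boxPartitionCount_succ_succ`, t07), one sweep per row `d`, as lists of natural
numbers — `O(ℓ · m · ℓm)` additions, a few kernel-seconds for the whole `8…15` grid.

## What is proved

* `GaussTable.getD_coeffList` : `(coeffList d n).getD s 0 = boxPartitionCount s d n` (all `d n s`);
* `GaussTable.boxPartitionCount_lt_of_strictBetween` : if the Boolean check
  `strictBetween (coeffList d n) a b` evaluates to `true` (by `decide +kernel`), then
  `p_{k-1}(d,n) < p_k(d,n)` for all `a ≤ k ≤ b`;
* `GaussTable.boxPartitionCount_eq_of_getD_eq` : equal table entries give equal coefficients (for the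
  equal-middle-coefficient exceptions of Pak–Panova's Thm. 6).

HONEST FRAMING: evaluation plumbing for elementary partition counting; nothing here bears on permanent
versus determinant; VP ≠ VNP is not proved.

## References

* G. E. Andrews, *The Theory of Partitions* (1984 ed.), Thm. 3.1 with eq. (3.3.4) (the `q`-Pascal rule
  for the Gaussian polynomials). [Andrews1984]
* I. Pak, G. Panova, *Strict unimodality of `q`-binomial coefficients*, C. R. Math. Acad. Sci. Paris 351
  (2013) 415–418 = arXiv:1306.5085, Thm. 6 (proof: "A direct calculation gives strict unimodality for
  each `ℓ ∈ {8,…,15}`, and `8 ≤ m < 16`"). [PakPanova2013]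
* J. Dörfler, C. Ikenmeyer, G. Panova, SIAM J. Appl. Algebra Geom. 4 (2020) = arXiv:1901.04576, §4
  (`p_r(a,b)`). [DorflerIkenmeyerPanova2020]

## Mathlib and tree

Mathlib: `List.getD_cons_zero`, `List.getD_cons_succ`, `List.getD_replicate`, `List.all_eq_true`,
`List.mem_range'_1`, `decide_eq_true_iff`.
Tree: `boxPartitionCount` (`DIP20MultiplicityObstructions`), `boxPartitionCount_succ_succ`,
`boxPartitionCount_eq_zero_of_lt` (`DIP20MonomialCounts`, t07), `boxPartitionCount_zero`
(`DIP20MultiplicityObstructions`).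

Provenance: val-lit cell, seat t05 g4 (discharge of `DIP20_cor_4_8` via Pak–Panova 2013).
-/

namespace Literature.Computability.AlgebraicComplexity

namespace GaussTable

/-! ### The evaluator -/

/-- Coefficientwise sum of two coefficient lists (the shorter one padded with zeros). [folklore] -/
def addCoeffs : List ℕ → List ℕ → List ℕ
  | [], ys => ys
  | x :: xs, [] => x :: xs
  | x :: xs, y :: ys => (x + y) :: addCoeffs xs ys

/-- One `q`-Pascal sweep along a row: from the accumulator `acc = G(d+1, n)` and the list
`[G(d, n+1), G(d, n+2), …]` of coefficient lists of the previous row, produce `[G(d+1, n+1), G(d+1, n+2), …]`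
by `G(d+1, n+1) = G(d, n+1) + q^{d+1} G(d+1, n)` (Andrews (3.3.4)). [cite: Andrews1984, Thm. 3.1 with eq. (3.3.4)] -/
def sweep (d : ℕ) : List ℕ → List (List ℕ) → List (List ℕ)
  | _, [] => []
  | acc, g :: gs =>
      let new := addCoeffs g (List.replicate (d + 1) 0 ++ acc)
      new :: sweep d new gs

/-- `rows d N = [G(d,1), G(d,2), …, G(d,N)]`, the coefficient lists of the Gaussian binomials
`binom(d+n, d)_q`, `1 ≤ n ≤ N`, computed row by row from `G(0, n) = 1` and `G(d+1, 0) = 1`.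
[cite: Andrews1984, Thm. 3.1 with eq. (3.3.4)] -/
def rows : ℕ → ℕ → List (List ℕ)
  | 0, N => List.replicate N [1]
  | d + 1, N => sweep d [1] (rows d N)

/-- `coeffList d n = [p_0(d,n), p_1(d,n), …, p_{dn}(d,n)]`, the coefficient list of `binom(d+n, d)_q`.
[cite: Andrews1984, Thm. 3.1 with eq. (3.3.4)] -/
def coeffList (d : ℕ) : ℕ → List ℕ
  | 0 => [1]
  | n + 1 => (rows d (n + 1)).getD n []

/-- The Boolean check "`L_{k-1} < L_k` for all `a ≤ k ≤ b`" on a coefficient list (Pak–Panova's "direct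
calculation" of strict unimodality for small boxes). [cite: PakPanova2013, Thm. 6 (proof: direct calculation for `ℓ ∈ {8,…,15}`, `8 ≤ m < 16`)] -/
def strictBetween (L : List ℕ) (a b : ℕ) : Bool :=
  (List.range' a (b + 1 - a)).all fun k => decide (L.getD (k - 1) 0 < L.getD k 0)

/-! ### Correctness -/

/-- `L` lists the coefficients `p_s(d,n)`, `s = 0, 1, …` (zeros beyond its end). [folklore] -/
private def Represents (L : List ℕ) (d n : ℕ) : Prop :=
  ∀ s, L.getD s 0 = boxPartitionCount s d n

/-- Entries of the coefficientwise sum. [folklore] -/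
private theorem getD_addCoeffs : ∀ (xs ys : List ℕ) (s : ℕ),
    (addCoeffs xs ys).getD s 0 = xs.getD s 0 + ys.getD s 0
  | [], ys, s => by simp [addCoeffs]
  | x :: xs, [], s => by simp [addCoeffs]
  | x :: xs, y :: ys, 0 => by simp [addCoeffs]
  | x :: xs, y :: ys, s + 1 => by
      rw [addCoeffs, List.getD_cons_succ, List.getD_cons_succ, List.getD_cons_succ]
      exact getD_addCoeffs xs ys s

/-- Entries of a list shifted up by `k` zeros (multiplication by `q^k`). [folklore] -/
private theorem getD_replicate_append (acc : List ℕ) :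
    ∀ (k s : ℕ), (List.replicate k 0 ++ acc).getD s 0 = if k ≤ s then acc.getD (s - k) 0 else 0
  | 0, s => by simp
  | k + 1, 0 => by simp [List.replicate_succ]
  | k + 1, s + 1 => by
      rw [List.replicate_succ, List.cons_append, List.getD_cons_succ, getD_replicate_append acc k s]
      simp only [Nat.add_le_add_iff_right, Nat.add_sub_add_right]

/-- The one-term list `[1]` lists `p_s(0, n) = [s = 0]` (no parts). [cite: DorflerIkenmeyerPanova2020, §4 (arXiv p. 9, `p_r(a,b)`)] -/
private theorem represents_one_zero_left (n : ℕ) : Represents [1] 0 n := by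
  intro s
  cases s with
  | zero => rw [List.getD_cons_zero, boxPartitionCount_zero]
  | succ s =>
    rw [List.getD_cons_succ, boxPartitionCount_eq_zero_of_lt (by omega)]
    rfl

/-- The one-term list `[1]` lists `p_s(d, 0) = [s = 0]` (all parts zero). [cite: DorflerIkenmeyerPanova2020, §4 (arXiv p. 9, `p_r(a,b)`)] -/
private theorem represents_one_zero_right (d : ℕ) : Represents [1] d 0 := by
  intro s
  cases s with
  | zero => rw [List.getD_cons_zero, boxPartitionCount_zero]
  | succ s =>
    rw [List.getD_cons_succ, boxPartitionCount_eq_zero_of_lt (by omega)]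
    rfl

/-- **The `q`-Pascal step on lists**: if `g` lists `G(d, n+1)` and `acc` lists `G(d+1, n)`, then
`g + q^{d+1}·acc` lists `G(d+1, n+1)` (`boxPartitionCount_succ_succ`). [cite: Andrews1984, Thm. 3.1 with eq. (3.3.4)] -/
private theorem represents_step {g acc : List ℕ} {d n : ℕ} (hg : Represents g d (n + 1))
    (hacc : Represents acc (d + 1) n) :
    Represents (addCoeffs g (List.replicate (d + 1) 0 ++ acc)) (d + 1) (n + 1) := by
  intro s
  rw [getD_addCoeffs, getD_replicate_append, hg s, boxPartitionCount_succ_succ]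
  split_ifs with h
  · rw [hacc]
  · rfl

/-- A sweep has the length of its input. [folklore] -/
private theorem length_sweep (d : ℕ) : ∀ (acc : List ℕ) (gs : List (List ℕ)),
    (sweep d acc gs).length = gs.length
  | _, [] => rfl
  | acc, g :: gs => by
      rw [sweep, List.length_cons, List.length_cons, length_sweep]

/-- `rows d N` has length `N`. [folklore] -/
private theorem length_rows : ∀ (d N : ℕ), (rows d N).length = N
  | 0, N => by simp [rows]
  | d + 1, N => by rw [rows, length_sweep, length_rows]

/-- **Invariant of a sweep**: if `acc` lists `G(d+1, n)` and the `j`-th input lists `G(d, n+1+j)`, then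
the `j`-th output lists `G(d+1, n+1+j)`. [cite: Andrews1984, Thm. 3.1 with eq. (3.3.4)] -/
private theorem sweep_spec (d : ℕ) : ∀ (gs : List (List ℕ)) (n : ℕ) (acc : List ℕ),
    Represents acc (d + 1) n →
    (∀ j, j < gs.length → Represents (gs.getD j []) d (n + 1 + j)) →
    ∀ j, j < gs.length → Represents ((sweep d acc gs).getD j []) (d + 1) (n + 1 + j)
  | [], n, acc, _, _, j, hj => absurd hj (Nat.not_lt_zero _)
  | g :: gs, n, acc, hacc, hgs, j, hj => by
      have hg : Represents g d (n + 1) := by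
        have h0 := hgs 0 (Nat.succ_pos _)
        rwa [List.getD_cons_zero, Nat.add_zero] at h0
      have hnew := represents_step hg hacc
      cases j with
      | zero =>
        rw [sweep, List.getD_cons_zero, Nat.add_zero]
        exact hnew
      | succ j =>
        rw [sweep, List.getD_cons_succ, show n + 1 + (j + 1) = (n + 1) + 1 + j by omega]
        refine sweep_spec d gs (n + 1) _ hnew (fun i hi => ?_) j (by simpa using hj)
        have h := hgs (i + 1) (by simpa using hi)
        rwa [List.getD_cons_succ, show n + 1 + (i + 1) = n + 1 + 1 + i by omega] at h

/-- **Invariant of the table**: the `j`-th entry of `rows d N` lists `G(d, j+1)` (`j < N`).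
[cite: Andrews1984, Thm. 3.1 with eq. (3.3.4)] -/
private theorem rows_spec : ∀ (d N j : ℕ), j < N → Represents ((rows d N).getD j []) d (j + 1)
  | 0, N, j, hj => by
      rw [rows, List.getD_replicate (h := hj)]
      exact represents_one_zero_left (j + 1)
  | d + 1, N, j, hj => by
      rw [rows, show j + 1 = 0 + 1 + j by omega]
      refine sweep_spec d (rows d N) 0 [1] (represents_one_zero_right (d + 1)) (fun i hi => ?_) j
        (by rwa [length_rows])
      rw [show 0 + 1 + i = i + 1 by omega]
      exact rows_spec d N i (by rwa [length_rows] at hi)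

/-- **The table is correct**: the `s`-th entry of `coeffList d n` is `p_s(d, n)`, the number of partitions
of `s` with at most `d` parts each at most `n` — for every `d, n, s` (entries beyond the end of the list
read `0 = p_s(d,n)`, `s > dn`). [cite: Andrews1984, Thm. 3.1 with eq. (3.3.4)] -/
theorem getD_coeffList (d n s : ℕ) : (coeffList d n).getD s 0 = boxPartitionCount s d n := by
  cases n with
  | zero => exact represents_one_zero_right d s
  | succ n => exact rows_spec d (n + 1) n (Nat.lt_succ_self n) s

/-- Soundness of the Boolean check on an arbitrary list. [folklore] -/
private theorem lt_of_strictBetween {L : List ℕ} {a b : ℕ} (h : strictBetween L a b = true) :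
    ∀ k, a ≤ k → k ≤ b → L.getD (k - 1) 0 < L.getD k 0 := by
  intro k hak hkb
  unfold strictBetween at h
  rw [List.all_eq_true] at h
  have hk : k ∈ List.range' a (b + 1 - a) := by
    rw [List.mem_range'_1]
    omega
  exact of_decide_eq_true (h k hk)

/-- **Strict increase of the Gaussian coefficients from the table** (Pak–Panova's "direct calculation"):
if `strictBetween (coeffList d n) a b` evaluates to `true`, then `p_{k-1}(d, n) < p_k(d, n)` for all
`a ≤ k ≤ b`. [cite: PakPanova2013, Thm. 6 (proof: "A direct calculation gives strict unimodality for each ℓ ∈ {8,…,15}, and 8 ≤ m < 16")] -/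
theorem boxPartitionCount_lt_of_strictBetween {d n a b : ℕ}
    (h : strictBetween (coeffList d n) a b = true) :
    ∀ k, a ≤ k → k ≤ b → boxPartitionCount (k - 1) d n < boxPartitionCount k d n := by
  intro k hak hkb
  rw [← getD_coeffList, ← getD_coeffList]
  exact lt_of_strictBetween h k hak hkb

/-- **Equal coefficients from the table**: equal entries of `coeffList d n` are equal Gaussian
coefficients (for the exceptional boxes of Pak–Panova's Thm. 6, whose middle coefficients coincide).
[cite: PakPanova2013, Thm. 6 (the exceptional values, "the middle three coefficients … are equal")] -/
theorem boxPartitionCount_eq_of_getD_eq {d n s t : ℕ}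
    (h : (coeffList d n).getD s 0 = (coeffList d n).getD t 0) :
    boxPartitionCount s d n = boxPartitionCount t d n := by
  rwa [getD_coeffList, getD_coeffList] at h

/-! ### Sanity values (kernel) -/

/-- `binom(6,3)_q = 1 + q + 2q² + 3q³ + 3q⁴ + 3q⁵ + 3q⁶ + 2q⁷ + q⁸ + q⁹` (Andrews, Example after Thm. 3.1).
[cite: Andrews1984, Thm. 3.1 with eq. (3.3.4)] -/
theorem coeffList_three_three : coeffList 3 3 = [1, 1, 2, 3, 3, 3, 3, 2, 1, 1] := by
  decide +kernel

/-- Cross-check with the enumerated values of `DIP20KeyDifferenceFormula.lean` (t07: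
`DIP20_cor_4_8_boxCounts_holds`, `boxPartitionCount_ten_seven_34_35`): `p_26(9,6) = p_27(9,6) = 227` and
`p_34(10,7) = p_35(10,7) = 734`. [cite: DorflerIkenmeyerPanova2020, Cor. 4.8 (proof, arXiv p. 12)] -/
theorem coeffList_values_nine_six_ten_seven :
    (coeffList 9 6).getD 26 0 = 227 ∧ (coeffList 9 6).getD 27 0 = 227 ∧
      (coeffList 10 7).getD 34 0 = 734 ∧ (coeffList 10 7).getD 35 0 = 734 := by
  decide +kernel

end GaussTable

end Literature.Computability.AlgebraicComplexity
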